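import Mathlib
import HarnessLib
import HarnessLib.Audit
import Summits.BirchSwinnertonDyer.Statement
import HarnessLib.Audit.Check
import Literature.NumberTheory.EllipticCurves.Selmer
import Literature.NumberTheory.EllipticCurves.Sha
import Literature.NumberTheory.EllipticCurves.QuadraticTwist
import Literature.NumberTheory.EllipticCurves.GlobalMinimalModel
import Literature.NumberTheory.EllipticCurves.GaloisAction
import Literature.NumberTheory.EllipticCurves.Tamagawa
import Literature.NumberTheory.DiophantineGeometry.Conductor
import Literature.NumberTheory.EllipticCurves.SelmerCorankHolds
import Literature.NumberTheory.EllipticCurves.GlobalMinimalModelProofs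
import Literature.NumberTheory.EllipticCurves.MinimalModelReduction
import Literature.NumberTheory.EllipticCurves.VariableChangePoints
import Literature.NumberTheory.DiophantineGeometry.LocalReductionProofs
import Literature.NumberTheory.DiophantineGeometry.MinimalModelUniquenessProofs
import Summits.BirchSwinnertonDyer.BirchSwinnertonDyer.Theorems.SelmerRankShaCorank
import Literature.NumberTheory.EllipticCurves.ModularCurve
import Literature.NumberTheory.EllipticCurves.ModularCurveKleinJ
import HarnessLib.Audit.Status.Attr

/-!
Route: MockTateDerivative

# Route MockTateDerivative — rank two on the non-split Tate sector from the first vertical Kolyvagin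
derivative of inert-conductor Heegner points (a finite-level mock plectic certificate), fed to
Fornea–Gehrmann

It suffices to show X = X1 ∧ X4 ∧ X3 where: X1 (MockNonVanishing, the new lever) — for a globally
minimal E/ℚ of analytic rank 2 with a
NON-SPLIT Tate prime p ≥ 5 (p ∥ N, a_p = −1, ρ̄_{E,p} surjective) and any imaginary quadratic K (d_K
< −4, (d_K, N) = 1, p inert,
every other prime of N split, r_an(E^{d_K}) = 0), some level n ≥ 2 carries the FINITE-LEVEL MOCK
PLECTIC CERTIFICATE: the
Pic(O_K)-trace of the Kolyvagin derivative D_σ y_n of a Heegner point y_n ∈ E(K[p^n]) of conductor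
p^n (σ a generator of the cyclic
group Gal(K[p^n]/K[1]) of order (p+1)p^{n−1}) is NOT divisible by p^{n−1} in E(K[p^n]) —
equivalently (Fornea–Gehrmann Lemma 2.8 +
E(K[p^∞])[p] = 0) the mock plectic invariant Q_K ≠ 0; X4 (SelmerRankShaPFinite, shared stmt-0132) —
Ш(E/ℚ)[p^∞] is finite;
X3 (BSDOffTateSector, declared RESIDUAL) — BSD-rank off that sector (r_an ≥ 3, or r_an = 2 without
such a prime). Supports (theorems in
print, typed here): VerticalKolyvagin (Fornea–Gehrmann Thm 1.1/3.4 in certificate form: certificate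
⟹ corank_{ℤ_p} Sel_{p^∞}(E/K) = 2),
FieldSupply (Friedberg–Hoffstein twist with the inert/split prescription), RankLeOne
(Gross–Zagier–Kolyvagin, shared stmt-17610),
QuadraticSelmerCorank (Selmer corank over a quadratic field = corank + corank of the twist; proved
in the tree). Since rev 1 (cone
repair) the Heegner data of X1 / VerticalKolyvagin are typed over light modules only: the CM point
x(p^n) is an explicit point of ℍ,
K[p^n] = K(j(x(p^n))) ⊆ ℂ (Cox Thm 11.1), the Galois action is Mathlib's `Affine.Point.map`, D_σ an
explicit sum.
Lean: `MockNonVanishing ∧ SelmerRankShaPFinite ∧ BSDOffTateSector`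

## Assembly
Certified in glue.lean (`closes`, sorry-free, all seven hypotheses consumed). Fix W elliptic; pass
to a global minimal model V
(`hasGlobalMinimalModel_rat_holds`; rank, local Euler factors and analytic rank are transported
along the isomorphism, T1–T3 as in
the certified closes of ToricShedding). If r_an(V) ≤ 1: RankLeOne. If V lies in the sector at (p,
M): FieldSupply gives K, β;
MockNonVanishing gives the certificate; VerticalKolyvagin gives corank Sel_{p^∞}(V/K) = 2; the
support item
QuadraticSelmerCorank (corank over K = corank(V) + corank(V^{d_K}); PROVED in the tree as
`selmerCorank_baseChange_quadratic_holds`, stated by name so the route file need not import the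
Dokchitser proof stack) with
RankLeOne + Greenberg's identity on the rank-0 twist gives corank Sel_{p^∞}(V/ℚ) = 2;
SelmerRankShaPFinite at p and `selmerCorank_eq_mordellWeilRank_add_holds` give
rank V(ℚ) = 2 = r_an. Otherwise BSDOffTateSector. Pure logic plus proved tree identities.

Rationale: WHY THIS LINE. Heegner points die in analytic rank 2 (y_K is torsion), but at a prime p INERT in K
where E has multiplicative reduction the CM points of
conductor p^n form a norm-compatible tower whose first DERIVATIVE survives: Bertolini–Darmon's
Heegner distribution on the Mumford–Tate
curve (BertoliniDarmon1996, Conj. 4.1(2): in the indefinite case it vanishes to order max(r̃⁺, r̃⁻)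
− 1) and its modern avatar, the mock
plectic invariant Q_K ∈ H¹(K, V_pE) ⊗ H¹_f(K_p, V_pE)^{−a_p} of Darmon–Fornea / Fornea–Gehrmann
(DarmonFornea2025; arXiv:2311.03100 §2).
Fornea–Gehrmann PROVE (arXiv:2311.03100 Thm 1.1 = Thm 3.4, via a bipartite Euler system à la
Howard2006/BertoliniDarmon2005 at a
multiplicative p and one inclusion of Perrin-Riou's Heegner main conjecture) that L(E/K,1) = 0 ∧ Q_K
≠ 0 ⟹ corank Sel_{p^∞}(E/K) = 2; so on
the non-split Tate sector BSD-rank reduces to ONE non-vanishing statement (X1 = the ⟸ half of their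
Conj. 2.13 composed with BSD) plus
Ш[p^∞]-finiteness, with the auxiliary K supplied unconditionally by FriedbergHoffstein1995.
Imported: Iwasawa theory at multiplicative
primes (bipartite Euler systems), CM theory on X₀(N) at p-power conductor (vertical Kolyvagin
derivative instead of the horizontal one),
analytic twist non-vanishing. No prior route uses an INDEFINITE-quaternionic derivative class at a
Tate prime: PlecticLegs works over a
totally real F with plectic points, VerticalContact / ToricShedding use DEFINITE Gross periods at
good primes, the Selmer/PAdicOrder
family reads p-adic L-functions; the negatives index (LeadingTermTamePinch) concerns good ordinary p
≥ 5 and is untouched.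

RANKED CRUXES. #2 MockNonVanishing (crux) — non-split Tate sector (E/ℚ globally minimal, r_an(E) =
2, p ≥ 5, N = pM with p ∤ M, E multiplicative and NON-split at p — typed as
¬HasSplitMultiplicativeReduction of the ℤ_p-minimal model —, ρ̄_{E,p} surjective) and admissible K
([K:ℚ] = 2, totally complex, d_K < −4, gcd(d_K, pM) = 1, p inert, β² − d_K = 4c with M ∣ c,
r_an(E^{d_K}) = 0) ⟹ there exist a modular parametrisation datum Dt of level N, a level n ≥ 2, the
CM points τ = x(p^n) = (−β + i√|d_K|)/(2p^n c) and τ₁ = x(1) of ℍ, the fields L = K(j(τ)) = K[p^n]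
and L₁ = K(j(τ₁)) = K[1] inside ℂ (Cox Thm 11.1), a point y ∈ E(L) mapping to φ_Dt(τ) ∈ E(ℂ), a
generator σ of Gal(L/L₁) and a transversal S of Gal(L/K) modulo Gal(L/L₁) (fixing subgroups of
Aut_ℚ(L)) such that Σ_{s∈S} s(Σ_{k<(p+1)p^{n−1}} k σ^k y) is not divisible by p^{n−1} in E(L). This
is "Q_K ≠ 0" at finite level; rev 1 re-typed it over ModularCurve/ModularCurveKleinJ + Mathlib only
(same mathematics as rev 0's ringClassField / heegnerPointComplexOfConductor / pointGalHom /
derivOp, whose home module dragged 120-odd unproved modularity-era facts into the import cone).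
[difficulty: open-problem] (why it might fail: It is the unproved ⟸ half of Fornea–Gehrmann Conj.
2.13 composed with BSD; no Gross–Zagier-type formula for Q_K exists and Q_K is not even numerically
computable (arXiv:2311.03100 §1), so Q_K might vanish identically on the sector for a reason
invisible to L-functions.) [arXiv:2311.03100, DarmonFornea2025, BertoliniDarmon1996,
CastellaHsieh2022]
#3 BSDOffTateSector (crux) — RESIDUAL (declared): for globally minimal E/ℚ with r_an ≥ 2 that is NOT
in the sector (no prime p ≥ 5 with N = pM, p ∤ M, E multiplicative at p with the ℤ_p-minimal model
not split multiplicative, ρ̄_{E,p} surjective, r_an = 2) one has r_an(E) = rank E(ℚ). Covers r_an ≥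
3 and, e.g., every rank-2 curve of prime conductor (split at its Tate prime, like 389a).
[difficulty: open-problem] (why it might fail: It IS BSD-rank on the complement of the sector (all
of r_an ≥ 3; rank-2 curves with only split or only small/non-surjective Tate primes): no mechanism
is offered here — declared residual, imported as the complement of the conjunct this route attacks.)
[CastellaHsieh2022, Kolyvagin1990, SilvermanAEC2009]
#4 SelmerRankShaPFinite (crux) — for every elliptic curve E/ℚ and every prime p, the p-primary part
Ш(E/ℚ)[p^∞] is finite (shared item stmt-BirchSwinnertonDyer-0132, verbatim). Consumed once per
curve, at the sector prime p, to pass from corank Sel_{p^∞}(E/ℚ) = 2 to rank E(ℚ) = 2. [difficulty: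
open-problem] (why it might fail: Known only for r_an ≤ 1 (Kolyvagin1990, Kato2004 Thm 14.2); for
r_an ≥ 2 nothing excludes an infinitely divisible element of Ш at every p (SilvermanAEC2009 X.4.13);
stronger than the one-prime cotorsion the glue consumes.) [Kolyvagin1990, Kato2004,
SilvermanAEC2009, GreenbergLNM1716]
#9 VerticalKolyvagin (support) — Fornea–Gehrmann's theorem (arXiv:2311.03100 Thm 1.1 = Thm 3.4, with
Lemma 2.8, Cor. 2.9, Prop. 2.11) in finite-level certificate form (same light typing of the Heegner
data as #2): on the non-split Tate sector with L(E,1) = 0 and admissible K (so N⁻ = 1, ε(E/K) = +1,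
L(E/K,1) = 0), if some level n ≥ 2 carries the certificate of MockNonVanishing then corank_{ℤ_p}
Sel_{p^∞}(E/K) = 2. A published theorem (bipartite Euler system at multiplicative p + one IMC
inclusion + p-parity), typed here as a support statement to be formalised or vendored as a cited
Literature fact. [difficulty: XL] [arXiv:2311.03100, Howard2006, BertoliniDarmon2005, Nekovar2006,
DarmonFornea2025]
#9 FieldSupply (support) — twist supply (a theorem): for E/ℚ with N = pM, p ∤ M and r_an(E) = 2
there is an imaginary quadratic K with d_K < −4, gcd(d_K, pM) = 1, p inert, every prime of M split
(β² − d_K = 4c with M ∣ c for some β, c) and r_an(E^{d_K}) = 0; 'imaginary quadratic' is typed as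
[K:ℚ] = 2 ∧ totally complex (the two conjuncts of IsImaginaryQuadratic, inlined). Proof in print:
ε(E) = +1 (even analytic rank), the prescribed residue classes give χ_{d_K}(−N) = +1 hence
ε(E^{d_K}) = +1, and Friedberg–Hoffstein Thm B gives infinitely many such d_K with L(E^{d_K},1) ≠ 0.
[difficulty: L] [FriedbergHoffstein1995, BumpFriedbergHoffstein1990, GrossZagier1986]
#9 RankLeOne (support) — the Gross–Zagier–Kolyvagin theorem (shared item
stmt-BirchSwinnertonDyer-17610, verbatim): r_an(E) ≤ 1 ⟹ rank E(ℚ) = r_an(E) and Ш(E/ℚ) finite. Used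
on the rank-0 twist E^{d_K} and for curves of analytic rank ≤ 1. [difficulty: XL] [GrossZagier1986,
Kolyvagin1990, BumpFriedbergHoffstein1990]
#9 QuadraticSelmerCorank (support) — for E/ℚ elliptic, K a quadratic number field and p prime:
corank_{ℤ_p} Sel_{p^∞}(E/K) = corank Sel_{p^∞}(E/ℚ) + corank Sel_{p^∞}(E^{d_K}/ℚ). Verbatim the body
of the tree fact Literature.NumberTheory.EllipticCurves.selmerCorank_baseChange_quadratic, PROVED by
selmerCorank_baseChange_quadratic_holds (BSDSelmerParityDokchitserBaseChangeProofs): a prover closes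
it in one line in a Theorems file; stated by name here so that the route file does not import that
168-module proof stack. [difficulty: provable-now] [DokchitserDokchitser2010, Greenberg1999]

TWO-LAYER PLAN. Foreseen glued split of MockNonVanishing (registered birth skeleton
bc/MockNonVanishing_birth.lean): MockNonVanishing ⇐ MockPConverse
(Selmer coranks (2, 0) for (E, E^{d_K}) on the sector ⟹ certificate: the open ⟸ half of the WEAK
Conj. 2.13, a p-converse for Q_K)
→ SectorSelmerCoranks (sector ⟹ corank Sel_{p^∞}(E) = 2 ∧ corank Sel_{p^∞}(E^{d_K}) = 0; LB by
Skinner's multiplicative converse +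
p-parity, UB shared with the SelmerRank family) → MockNonVanishing; alternative split along a mock
p-adic Gross–Zagier formula
(certificate ⟺ second derivative of the Bertolini–Darmon anticyclotomic p-adic L at 𝟙 ≠ 0) once the
theta element is typed.
BSDOffTateSector ⇐ RankGeThree → RankTwoOffSector (regime split, residual). SelmerRankShaPFinite ⇐
ShaCorankZero → FiniteOfCorankZero.

KILL CRITERIA. A sector triple (E, p, K) with r_an(E) = 2, r_an(E^{d_K}) = 0 and Q_K = 0
(equivalently: the certificate fails at every n ≥ 2; by
trace-compatibility it suffices that it fails at ONE n ≥ n₀ where p^{n₀−1} exceeds the index of the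
relevant lattice) refutes
MockNonVanishing — close `refuted:MockNonVanishing` (it would also refute Fornea–Gehrmann Conj. 2.13
⟸ ∘ BSD, news either way). A
curve with Ш(E/ℚ)[p^∞] infinite kills SelmerRankShaPFinite and every Selmer-based route at once. If
VerticalKolyvagin's typed form is
shown NOT to follow from arXiv:2311.03100 Thm 3.4 (e.g. a hypothesis of the paper — CR on N⁻, p ∤
h_K·… — is missing from the typed
sector), pivot: add the missing hypothesis to the sector predicate in
MockNonVanishing/VerticalKolyvagin/BSDOffTateSector simultaneously
(route edit --restate ×3; closes is insensitive to the predicate's content).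

NOT DECOMPOSED YET. The p-converse / mock Gross–Zagier decomposition of MockNonVanishing (layer 2,
after the crux is vetted); the formalisation of
VerticalKolyvagin (a whole paper: bipartite Euler system, level raising at p ∥ N via Skinner–Zhang,
Nekovář's local conditions, one IMC
inclusion) — it is a support statement to be vendored as a cited fact, not decomposed; the
Friedberg–Hoffstein input of FieldSupply;
any attack on the residual BSDOffTateSector (other routes: generalised Kato classes at good p,
CastellaHsieh2022).

CHEAPEST FALSIFIER. (1) Signature audit of VerticalKolyvagin against arXiv:2311.03100 §1 hypotheses
(p ≥ 5, ρ̄ surjective, CR on N⁻ — vacuous here since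
N⁻ = 1 —, K ≠ ℚ(i), ℚ(√−3), p inert, N unramified in K, ε(E/K) = +1): a refuter checks each is
implied by the typed sector/field
predicates (I did: N⁻ = 1 because 4M ∣ β² − d_K splits every prime of M; d_K < −4 excludes ℚ(i),
ℚ(√−3); gcd(d_K, pM) = 1). (2) The
decidable instance: Fornea–Gehrmann Example 1.5 (817 = 19·43, K = ℚ(√−7), p = 19): compute the
certificate at n = 2 — currently
infeasible (no numerical method for Q_K is known, arXiv:2311.03100 p. 3), recorded as the BC5
plan-only rung. (3) Lookup: is the
⟸ half of Conj. 2.13 (or BD96 Conj. 4.1(2)) proved anywhere for r_an = 2? Searched (Novelty): no.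

NUMBERS. Sector constants: p ≥ 5, p ∥ N, a_p(E) = −1 (so δ_p⁺ = 0, δ_p⁻ = 1 in arXiv:2311.03100
Conj. 2.13 and the prediction is Q_K ≠ 0 ⟺
max{r_alg(E), r_alg(E^K) + 1} = 2 ⟺ rank E(ℚ) = 2 given rank E^K(ℚ) = 0); [K[p^n] : K[1]] =
(p+1)p^{n−1} (p inert, d_K < −4);
D_σ = Σ_{k<(p+1)p^{n−1}} kσ^k; certificate modulus p^{n−1}; smallest sector example: N = 817 = 19·43
(arXiv:2311.03100 Ex. 1.5).
Items at open: 7 (3 cruxes, 3 supports, 1 assembly); since rev 1: 8 items (3 cruxes + auto-crux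
RankLeOne, 4 supports incl. QuadraticSelmerCorank, 1 assembly); closes binders: 7, all consumed.

DEFINITION REQUESTS. None. Rev 1 (cone repair 2026-08-17): the route file imports only the light BSD
stack + Literature.NumberTheory.EllipticCurves.ModularCurve (ModularParametrizationData, φ) +
ModularCurveKleinJ (kleinJ); the Heegner data are typed inline — x(p^n) ∈ ℍ by its coordinates (=
coe_heegnerPointOfConductor of HeegnerPointsOfConductor, n ↦ p^n), K[p^n] := Subfield.closure (ι(K)
∪ {j(x(p^n))}) (= ringClassField by Cox Thm 11.1 and
kleinJ_heegnerPointOfConductor_mem_ringClassField), Gal groups as fixingSubgroup of Aut_ℚ, the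
action by WeierstrassCurve.Affine.Point.map (= pointGalHom_apply, rfl), D_σ y = Σ_{i<(p+1)p^{n−1}}
i•σ^i y (= KolyvaginOperator.derivOp, rfl); HasSplitMultiplicativeReductionAtPrime and
IsImaginaryQuadratic are inlined by their bodies. A prover who wants the HeegnerPointsOfConductor
API imports it in the THEOREMS file and bridges with those lemmas. needs-fact (genuinely
load-bearing, unproved, still in the cone): WeierstrassCurve.hasEntireLFunction_rat (analyticRank
itself), ModularForms.exists_isNewformOf + existsUnique_isNewformOf +
nonempty_modularParametrizationData (modularity: the ∃ Dt of MockNonVanishing),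
ModularParametrizationData.φ_gamma0_smul + φ_eq_of_mk_eq_mk (Γ₀(N)-invariance of φ, used to put y in
E(K[p^n])); abs_maninConstant_eq_one_of_isSemistable rides along in ModularCurve.lean unused. Cite
facts wanted later (not filed now): arXiv:2311.03100 Thm 3.4 as a Literature fact (=
VerticalKolyvagin), FriedbergHoffstein1995 Thm B (= FieldSupply).

Novelty: Searches (2026-08-17): `lit galaxy search "mock plectic" --star all` (0 rows: panama 0, pdf 0,
crabby 0); `lit galaxy search
"mock plectic|Mumford-Tate curves|bipartite Euler" --star pdf` (2 rows, both off-topic); `lit citing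
arxiv:2311.03100` (2: arXiv:2312.01481,
arXiv:2401.07737 — neither proves a non-vanishing of Q_K); `lit citing arxiv:2310.16758` (4); `lit
search --hybrid "non-vanishing of the
mock plectic invariant … converse"` (8 textbook rows, none on topic); `lit vsearch "… first
derivative of the Heegner distribution at the
inert multiplicative prime does not vanish" --papers` (4, none on topic); `lit search "Heegner
points on Mumford-Tate curves"` (held:
paper:doi-10-1007-s002220050105, read p. 445 Conj. 4.1–4.2); `lit read paper:arxiv-2311.03100` (pp.
3, 4, 8, 9, 11 read);
`ledger negatives --problem BirchSwinnertonDyer` (1 entry, unrelated); the 13 existing Theses of the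
sub read for levers.
Nearest prior art found: [corpus:paper-arxiv-2311.03100 p.3, p.9] Fornea–Gehrmann Thm 1.1 (Q_K ≠ 0 ⟹
r_p(E/K) = 2) and Conj. 2.13
(Q_K ≠ 0 ⟺ max{r_alg^± + δ^±} = 2, open); [corpus:paper-doi-10-1007-s002220050105 p.445]
BertoliniDarmon1996 Conj. 4.1(2) (order of
vanishing of the Heegner distribution, indefinite case); DarmonFornea2025 Thm 3.9 (rank-0 use of
Q_K); CastellaHsieh2022 (the good-ordinary
analogue with generalised Kato classes); nearest routes: VerticalContact (definite Gross periods in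
the Hida family, good p) and
PlecticLegs (plectic points over totally real F).  [refs: 2311.03100, 2312.01481, 2401.07737, 2310.16758, arxiv:2311.03100, arxiv:2310.16758, paper:doi-10-1007-s002220050105, paper:arxiv-2311.03100, paper-arxiv-2311.03100, paper-doi-10-1007-s002220050105, BertoliniDarmon1996, DarmonFornea2025, CastellaHsieh2022]

Barriers (technique_class: mock-plectic, bipartite-ES, vertical-Kolyvagin): - technique_class: mock-plectic, bipartite-ES, vertical-Kolyvagin
- Literature.Barriers.BirchSwinnertonDyer.HeegnerPointBarrier: outside — the barrier (y_K torsion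
when r_an ≥ 2; file HeegnerPointsRankOne) kills the TRACE of the tower; the certificate is the first
Kolyvagin DERIVATIVE Σ_s s(D_σ y_n) mod p^{n−1} of conductor-p^n points, which the barrier does not
quantify over (Bertolini–Darmon's "derivative of the Heegner distribution"; arXiv:2311.03100 Lemma
2.8: Trace P_1 = 0 is the barrier itself and the derivative survives it).
- Literature.Barriers.BirchSwinnertonDyer.AnticyclotomicHeightDegeneracy: outside — no height
pairing is used; the anti-equivariance mechanism (τ acts by −1 on a rank-1 receptacle) is defused by
the hypothesis ¬HasSplitMultiplicativeReductionAtPrime p: with a_p(E) = −1 the local factor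
H¹_f(K_p,V)^{−a_p} is the τ = +1 line E(ℚ_p) ⊗ ℚ_p, on which the regulator of P ∧ Q ∈ Λ²E(ℚ) is
log(Q)·κ(P) − log(P)·κ(Q) ≠ 0. The same hypothesis answers the uncatalogued PlecticDeterminantOverQ
file (receptacle H¹(K,V) ⊗ H¹_f(K_p,V)^{−a_p} has ONE local column, arXiv:2311.03100 Rem 2.10, not a
determinant of r = 2 localisations).
- Literature.Barriers.BirchSwinnertonDyer.ExceptionalZeroBarrier: outside for E (a_p(E) = −1: no
split-multiplicative trivial zero on the E-side, and no p-adic L-function is differentiated); the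
trivial zero sits on the twist E^{d_K} (a_p(E^{d_K}) = +1, δ⁻ = 1 in arXiv:2311.03100 Conj. 2.13),
which is why the line imposes r_an(E^{d_K}) = 0

History (route lifecycle, newest last):
- 2026-08-17T16:12:03Z · AUTO-CRUX (open): RankLeOne — hypotheses of the deciding theorem that nothing in the route derives are cruxes (planner-type-c28b6c9fea-0)
- 2026-08-17T16:46:22Z · rev 1: restated MockNonVanishing (stmt-BirchSwinnertonDyer-18492), BSDOffTateSector (stmt-BirchSwinnertonDyer-18493), VerticalKolyvagin (stmt-BirchSwinnertonDyer-18494), FieldSupply (stmt-BirchSwinnertonDyer-18495) — cone repair (rrepair, repair_kind=cone): drop imports HeegnerPointsOfConductor (456-module closure, ~12 (planner-rrepair-BirchSwinnertonDyer-MockTateDe-a33365ac-0)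
- 2026-08-17T16:47:13Z · rev 2: restated Assembly (stmt-BirchSwinnertonDyer-18496) — cone repair follow-up: Assembly item aligned with the rev-1 deciding theorem (7 binders incl. QuadraticSelmerCorank). (planner-rrepair-BirchSwinnertonDyer-MockTateDe-a33365ac-0)

sub-problem: BirchSwinnertonDyer · status: draft · opened planner-type-c28b6c9fea-0 2026-08-17T16:11:46Z · rev 3 · ledger route-BirchSwinnertonDyer-MockTateDerivative
GENERATED by the gate from the ledger (D-0016/17). Provers cite these decls: `theorem foo : Summit.BirchSwinnertonDyer.BirchSwinnertonDyer.Theses.MockTateDerivative.<Decl> := …` in Summits/BirchSwinnertonDyer/BirchSwinnertonDyer/Theorems/<Name>.lean.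
-/

namespace Summit.BirchSwinnertonDyer.BirchSwinnertonDyer.Theses.MockTateDerivative

open scoped BigOperators Topology Manifold Classical MeasureTheory ProbabilityTheory Matrix InnerProductSpace ComplexConjugate ContinuousMap
open Filter Set Function TopologicalSpace MeasureTheory

attribute [summit_statement] _root_.BirchSwinnertonDyer

open Literature

-- earlier MockNonVanishing (stmt-BirchSwinnertonDyer-18492, replaced 2026-08-17T16:46:22Z -> stmt-BirchSwinnertonDyer-18592): retired by None — ∀ (W : WeierstrassCurve ℚ) [W.IsElliptic] [W.IsGloballyMinimal] (p M : ℕ) [Fact p.Prime] [NeZero (W.conductorNorm ℤ)], 5 ≤ p → W.conductorNorm ℤ = p * M → ¬ p ∣ M → W.HasMultiplicativeReductionAtPrime p → ¬ W.HasSplitMultiplicativeReductionAtPrime p → W.HasS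
/-- item stmt-BirchSwinnertonDyer-18592 · crux · rank 2 · open · by planner
why it might fail: It is the unproved ⟸ half of Fornea–Gehrmann Conj. 2.13 composed with BSD; no Gross–Zagier-type formula for Q_K exists and Q_K is not even numerically computable (arXiv:2311.03100 §1), so Q_K may vanish on the sector; also y ∈ E(K(j(x(p^n)))) leans on CM rationality of φ(x(p^n)).
sources: arXiv:2311.03100, DarmonFornea2025, BertoliniDarmon1996, CastellaHsieh2022, Cox2013
[crux] non-split Tate sector (E/ℚ globally minimal, r_an(E) = 2, p ≥ 5, N = pM with p ∤ M, E
multiplicative at p and the ℤ_p-minimal model NOT split multiplicative, ρ̄_{E,p} surjective) and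
admissible K ([K:ℚ] = 2, totally complex, d_K < −4, gcd(d_K, pM) = 1, p inert, β² − d_K = 4c with M
∣ c, r_an(E^{d_K}) = 0) ⟹ ∃ a modular parametrisation datum Dt of level N, a level n ≥ 2, the CM
points τ = x(p^n) = (−β + i√|d_K|)/(2 p^n c), τ₁ = x(1) = (−β + i√|d_K|)/(2c) of ℍ, the subfields L
= K(j(τ)) (= K[p^n], Cox Thm 11.1) and L₁ = K(j(τ₁)) (= K[1]) of ℂ, a point y ∈ E(L) mapping to
φ_Dt(τ) ∈ E(ℂ), a generator σ of Gal(L/L₁) and a transversal S of Gal(L/K) mod Gal(L/L₁) (fixing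
subgroups of Aut_ℚ L) with Σ_{s∈S} s(Σ_{i<(p+1)p^{n−1}} i σ^i y) NOT divisible by p^{n−1} in E(L):
'Q_K ≠ 0' at finite level (rev 1: re-typed over ModularCurve/ModularCurveKleinJ + Mathlib; rev 0
used ringClassField/heegnerPointComplexOfConductor/pointGalHom/derivOp of HeegnerPointsOfConductor,
equal to these by coe_heegnerPointOfConductor, kleinJ_heegnerPointOfConductor_mem_ringClassField +
Cox 11.1, pointGalHom_apply, derivOp). [deps: FieldSupply] [difficulty: open-problem] -/
@[route_item "route-BirchSwinnertonDyer-MockTateDerivative", crux]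
def MockNonVanishing : Prop :=
  ∀ (W : WeierstrassCurve ℚ) [W.IsElliptic] [W.IsGloballyMinimal] (p M : ℕ) [Fact p.Prime] [NeZero (W.conductorNorm ℤ)], 5 ≤ p → W.conductorNorm ℤ = p * M → ¬ p ∣ M → W.HasMultiplicativeReductionAtPrime p → ¬ ((W.baseChange ℚ_[p]).minimal ℤ_[p]).HasSplitMultiplicativeReduction ℤ_[p] → W.HasSurjectiveModNGaloisRep p → W.analyticRank = 2 → ∀ (K : Type) [Field K] [NumberField K] (ι : K →+* ℂ) (β c : ℤ), Module.finrank ℚ K = 2 → NumberField.IsTotallyComplex K → NumberField.discr K < -4 → Int.gcd (NumberField.discr K) (p * M) = 1 → ((Ideal.span {(p : ℤ)}).primesOver (NumberField.RingOfIntegers K)).ncard = 1 → β ^ 2 - NumberField.discr K = 4 * c → (M : ℤ) ∣ c → (W.quadraticTwist (NumberField.discr K : ℚ)).analyticRank = 0 → ∃ (Dt : Literature.NumberTheory.EllipticCurves.ModularForms.ModularParametrizationData W (W.conductorNorm ℤ)) (n : ℕ) (τ τ₁ : UpperHalfPlane) (L L₁ : Subfield ℂ) (y : (W.baseChange L).toAffine.Point)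 (σ : (L ≃ₐ[ℚ] L)) (S : Finset (L ≃ₐ[ℚ] L)), 2 ≤ n ∧ (τ : ℂ) = ⟨-(β : ℝ) / (2 * (p ^ n : ℕ) * c), Real.sqrt (-(NumberField.discr K : ℝ)) / (2 * (p ^ n : ℕ) * c)⟩ ∧ (τ₁ : ℂ) = ⟨-(β : ℝ) / (2 * c), Real.sqrt (-(NumberField.discr K : ℝ)) / (2 * c)⟩ ∧ L = Subfield.closure (Set.range ι ∪ {Literature.NumberTheory.EllipticCurves.ModularForms.kleinJ τ}) ∧ L₁ = Subfield.closure (Set.range ι ∪ {Literature.NumberTheory.EllipticCurves.ModularForms.kleinJ τ₁}) ∧ WeierstrassCurve.Affine.Point.map L.subtype.toRatAlgHom y = Dt.φ τ ∧ Subgroup.zpowers σ = fixingSubgroup (L ≃ₐ[ℚ] L) {x : L | (x : ℂ) ∈ L₁} ∧ (∀ s ∈ S, s ∈ fixingSubgroup (L ≃ₐ[ℚ] L) {x : L | (x : ℂ) ∈ Set.range ι}) ∧ (∀ g ∈ fixingSubgroup (L ≃ₐ[ℚ] L) {x : L | (x : ℂ) ∈ Set.range ι}, ∃! s, s ∈ S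 ∧ g⁻¹ * s ∈ fixingSubgroup (L ≃ₐ[ℚ] L) {x : L | (x : ℂ) ∈ L₁}) ∧ ¬ ∃ z : (W.baseChange L).toAffine.Point, (p ^ (n - 1)) • z = ∑ s ∈ S, WeierstrassCurve.Affine.Point.map (W' := W) (s : L →ₐ[ℚ] L) (∑ i ∈ Finset.range ((p + 1) * p ^ (n - 1)), i • WeierstrassCurve.Affine.Point.map (W' := W) ((σ ^ i : L ≃ₐ[ℚ] L) : L →ₐ[ℚ] L) y)

-- earlier BSDOffTateSector (stmt-BirchSwinnertonDyer-18493, replaced 2026-08-17T16:46:22Z -> stmt-BirchSwinnertonDyer-18593): retired by None — ∀ (W : WeierstrassCurve ℚ) [W.IsElliptic] [W.IsGloballyMinimal], 2 ≤ W.analyticRank → (¬ ∃ (p M : ℕ) (_ : Fact p.Prime), 5 ≤ p ∧ W.conductorNorm ℤ = p * M ∧ ¬ p ∣ M ∧ W.HasMultiplicativeReductionAtPrime p ∧ ¬ W.HasSplitMultiplicativeReductionAtPrime p ∧ W.Ha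
/-- item stmt-BirchSwinnertonDyer-18593 · crux · rank 3 · open · by planner
why it might fail: It IS BSD-rank on the complement of the sector (all of r_an ≥ 3; rank-2 curves with only split or only small/non-surjective Tate primes): no mechanism is offered here — declared residual, imported as the complement of the conjunct this route attacks.
sources: CastellaHsieh2022, Kolyvagin1990, SilvermanAEC2009
[crux] RESIDUAL (declared): for globally minimal E/ℚ with r_an ≥ 2 that is NOT in the sector (no
prime p ≥ 5 with N = pM, p ∤ M, E multiplicative at p with ℤ_p-minimal model not split
multiplicative — the body of HasSplitMultiplicativeReductionAtPrime, inlined so PAdicHeights is not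
imported —, ρ̄_{E,p} surjective, r_an = 2) one has r_an(E) = rank E(ℚ). Covers r_an ≥ 3 and, e.g.,
every rank-2 curve of prime conductor split at its Tate prime (389a). [difficulty: open-problem] -/
@[route_item "route-BirchSwinnertonDyer-MockTateDerivative", crux]
def BSDOffTateSector : Prop :=
  ∀ (W : WeierstrassCurve ℚ) [W.IsElliptic] [W.IsGloballyMinimal], 2 ≤ W.analyticRank → (¬ ∃ (p M : ℕ) (_ : Fact p.Prime), 5 ≤ p ∧ W.conductorNorm ℤ = p * M ∧ ¬ p ∣ M ∧ W.HasMultiplicativeReductionAtPrime p ∧ ¬ ((W.baseChange ℚ_[p]).minimal ℤ_[p]).HasSplitMultiplicativeReduction ℤ_[p] ∧ W.HasSurjectiveModNGaloisRep p ∧ W.analyticRank = 2) → W.analyticRank = W.mordellWeilRank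

/-- item stmt-BirchSwinnertonDyer-0132 · crux · rank 4 · open · by planner
why it might fail: Known only for r_an ≤ 1 (Kolyvagin1990, Kato2004 Thm 14.2); for r_an ≥ 2 nothing excludes an infinitely divisible element of Ш at every p (SilvermanAEC2009 X.4.13); stronger than the one-prime cotorsion the glue consumes.
sources: Kolyvagin1990, Kato2004, SilvermanAEC2009, GreenbergLNM1716
p-primary Tate–Shafarevich finiteness (weaker than Literature.BSD.ShaFiniteConjecture, prime by
prime). Known when r_an ≤ 1 (Kolyvagin1990 Thm A; Kato2004 Thm 14.2 =
Literature.NumberTheory.EllipticCurves.kato_finite_of_L_one_ne_zero for r_an = 0). Tate1974 §1.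
imports: Summits.BirchSwinnertonDyer.Statement,
Literature.NumberTheory.EllipticCurves.{Selmer,Sha,Heights,GaloisAction,Tamagawa,BSDInvariants}
(routes/Sketch.lean, lean check rc 0 on 2026-08-13). -/
@[route_item "route-BirchSwinnertonDyer-MockTateDerivative", crux]
def SelmerRankShaPFinite : Prop :=
  ∀ (W : WeierstrassCurve ℚ) [W.IsElliptic] (p : ℕ) [Fact p.Prime], Finite ↥(AddCommGroup.primaryComponent W.sha p)

/-- item stmt-BirchSwinnertonDyer-17610 · crux (kind.auto-crux: conjecture-grade) · rank 9 · open · by planner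
why it might fail: auto-crux — conjecture-grade (docstring avows it ('conjecture')): the deciding theorem assumes it and nothing in the route derives it, so it is a bet, not glue
sources: GrossZagier1986, Kolyvagin1990, BumpFriedbergHoffstein1990
[support] literature leaf (Gross–Zagier–Kolyvagin, Darmon2004 Thm 3.22): ord_(s=1) L(E,s) ≤ 1 ⇒
rank_ℤ E(ℚ) = ord_(s=1) L(E,s) and Ш(E/ℚ) finite — verbatim the body of the tree fact
Literature.NumberTheory.EllipticCurves.rank_eq_analyticRank_of_analyticRank_le_one; analytic rank ≤
1 never enters EdgeDecay (where it would be Schneider's conjecture in rank one). [difficulty: XL] -/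
@[route_item "route-BirchSwinnertonDyer-MockTateDerivative", crux]
def RankLeOne : Prop :=
  ∀ (W : WeierstrassCurve ℚ) [W.IsElliptic] (h : W.analyticRank ≤ 1), W.mordellWeilRank = W.analyticRank ∧ Finite W.sha

-- earlier VerticalKolyvagin (stmt-BirchSwinnertonDyer-18494, replaced 2026-08-17T16:46:22Z -> stmt-BirchSwinnertonDyer-18594): retired by None — ∀ (W : WeierstrassCurve ℚ) [W.IsElliptic] [W.IsGloballyMinimal] (p M : ℕ) [Fact p.Prime] [NeZero (W.conductorNorm ℤ)], 5 ≤ p → W.conductorNorm ℤ = p * M → ¬ p ∣ M → W.HasMultiplicativeReductionAtPrime p → ¬ W.HasSplitMultiplicativeReductionAtPrime p → W.Has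
/-- item stmt-BirchSwinnertonDyer-18594 · support · rank 9 · open · by planner
sources: arXiv:2311.03100, Howard2006, BertoliniDarmon2005, Nekovar2006, DarmonFornea2025
[support] Fornea–Gehrmann's theorem (arXiv:2311.03100 Thm 1.1 = Thm 3.4, with Lemma 2.8, Cor. 2.9,
Prop. 2.11) in finite-level certificate form, with the Heegner data typed exactly as in
MockNonVanishing (rev 1, light modules): on the non-split Tate sector with L(E,1) = 0 (1 ≤ r_an) and
admissible K (so N⁻ = 1, ε(E/K) = +1, L(E/K,1) = 0), if for some Dt, n ≥ 2, τ = x(p^n), τ₁ = x(1), L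
= K(j(τ)), L₁ = K(j(τ₁)), y ∈ E(L) over φ_Dt(τ), generator σ of Gal(L/L₁) and transversal S the sum
Σ_{s∈S} s(D_σ y) is not divisible by p^{n−1} in E(L), then corank_{ℤ_p} Sel_{p^∞}(E/K) = 2. A
published theorem (bipartite Euler system at multiplicative p + one IMC inclusion + p-parity), to be
formalised or vendored as a cited Literature fact and bridged to this typing. [difficulty: XL] -/
@[route_item "route-BirchSwinnertonDyer-MockTateDerivative", crux]
def VerticalKolyvagin : Prop :=
  ∀ (W : WeierstrassCurve ℚ) [W.IsElliptic] [W.IsGloballyMinimal] (p M : ℕ) [Fact p.Prime] [NeZero (W.conductorNorm ℤ)], 5 ≤ p → W.conductorNorm ℤ = p * M → ¬ p ∣ M → W.HasMultiplicativeReductionAtPrime p → ¬ ((W.baseChange ℚ_[p]).minimal ℤ_[p]).HasSplitMultiplicativeReduction ℤ_[p] → W.HasSurjectiveModNGaloisRep p → 1 ≤ W.analyticRank → ∀ (K : Type) [Field K] [NumberField K] (ι : K →+* ℂ) (β c : ℤ), Module.finrank ℚ K = 2 → NumberField.IsTotallyComplex K → NumberField.discr K < -4 → Int.gcd (NumberField.discr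 K) (p * M) = 1 → ((Ideal.span {(p : ℤ)}).primesOver (NumberField.RingOfIntegers K)).ncard = 1 → β ^ 2 - NumberField.discr K = 4 * c → (M : ℤ) ∣ c → ∀ (Dt : Literature.NumberTheory.EllipticCurves.ModularForms.ModularParametrizationData W (W.conductorNorm ℤ)) (n : ℕ) (τ τ₁ : UpperHalfPlane) (L L₁ : Subfield ℂ) (y : (W.baseChange L).toAffine.Point) (σ : (L ≃ₐ[ℚ] L)) (S : Finset (L ≃ₐ[ℚ] L)), 2 ≤ n → (τ : ℂ) = ⟨-(β : ℝ) / (2 * (p ^ n : ℕ) * c), Real.sqrt (-(NumberField.discr K : ℝ)) / (2 * (p ^ n : ℕ) * c)⟩ → (τ₁ : ℂ) = ⟨-(β : ℝ) / (2 * c), Real.sqrt (-(NumberField.discr K : ℝ)) / (2 * c)⟩ → L = Subfield.closure (Set.range ι ∪ {Literature.NumberTheory.EllipticCurves.ModularForms.kleinJ τ}) → L₁ = Subfield.closure (Set.range ι ∪ {Literature.NumberTheory.EllipticCurves.ModularForms.kleinJ τ₁}) → WeierstrassCurve.Affine.Point.map L.subtype.toRatAlgHom y = Dt.φ τ → Subgroup.zpowers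 σ = fixingSubgroup (L ≃ₐ[ℚ] L) {x : L | (x : ℂ) ∈ L₁} → (∀ s ∈ S, s ∈ fixingSubgroup (L ≃ₐ[ℚ] L) {x : L | (x : ℂ) ∈ Set.range ι}) → (∀ g ∈ fixingSubgroup (L ≃ₐ[ℚ] L) {x : L | (x : ℂ) ∈ Set.range ι}, ∃! s, s ∈ S ∧ g⁻¹ * s ∈ fixingSubgroup (L ≃ₐ[ℚ] L) {x : L | (x : ℂ) ∈ L₁}) → (¬ ∃ z : (W.baseChange L).toAffine.Point, (p ^ (n - 1)) • z = ∑ s ∈ S, WeierstrassCurve.Affine.Point.map (W' := W) (s : L →ₐ[ℚ] L) (∑ i ∈ Finset.range ((p + 1) * p ^ (n - 1)), i • WeierstrassCurve.Affine.Point.map (W' := W) ((σ ^ i : L ≃ₐ[ℚ] L) : L →ₐ[ℚ] L) y)) → (W.baseChange K).selmerCorank p = 2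

-- earlier FieldSupply (stmt-BirchSwinnertonDyer-18495, replaced 2026-08-17T16:46:22Z -> stmt-BirchSwinnertonDyer-18595): retired by None — ∀ (W : WeierstrassCurve ℚ) [W.IsElliptic] (p M : ℕ) [Fact p.Prime], W.conductorNorm ℤ = p * M → ¬ p ∣ M → W.analyticRank = 2 → ∃ (K : Type) (_ : Field K) (_ : NumberField K) (β : ℤ), Literature.NumberTheory.EllipticCurves.IsImaginaryQuadratic K ∧ NumberField.disc
/-- item stmt-BirchSwinnertonDyer-18595 · support · rank 9 · open · by planner
sources: FriedbergHoffstein1995, BumpFriedbergHoffstein1990, GrossZagier1986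
[support] twist supply (a theorem): for E/ℚ with N = pM, p ∤ M and r_an(E) = 2 there is a number
field K with [K:ℚ] = 2 and totally complex (imaginary quadratic), d_K < −4, gcd(d_K, pM) = 1, p
inert, and β, c ∈ ℤ with β² − d_K = 4c, M ∣ c (every prime of M split; rev 0 wrote 4M ∣ β² − d_K)
and r_an(E^{d_K}) = 0. Proof in print: ε(E) = +1 (even analytic rank), the prescribed residue
classes give χ_{d_K}(−N) = +1 hence ε(E^{d_K}) = +1, and Friedberg–Hoffstein Thm B gives infinitely
many such d_K with L(E^{d_K},1) ≠ 0. [difficulty: L] -/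
@[route_item "route-BirchSwinnertonDyer-MockTateDerivative", crux]
def FieldSupply : Prop :=
  ∀ (W : WeierstrassCurve ℚ) [W.IsElliptic] (p M : ℕ) [Fact p.Prime], W.conductorNorm ℤ = p * M → ¬ p ∣ M → W.analyticRank = 2 → ∃ (K : Type) (_ : Field K) (_ : NumberField K) (β c : ℤ), Module.finrank ℚ K = 2 ∧ NumberField.IsTotallyComplex K ∧ NumberField.discr K < -4 ∧ Int.gcd (NumberField.discr K) (p * M) = 1 ∧ ((Ideal.span {(p : ℤ)}).primesOver (NumberField.RingOfIntegers K)).ncard = 1 ∧ β ^ 2 - NumberField.discr K = 4 * c ∧ (M : ℤ) ∣ c ∧ (W.quadraticTwist (NumberField.discr K : ℚ)).analyticRank = 0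

/-- item stmt-BirchSwinnertonDyer-18596 · support · rank 9 · open · by planner
sources: DokchitserDokchitser2010, Greenberg1999
[support] for E/ℚ elliptic, K a number field with [K:ℚ] = 2 and p prime: corank_{ℤ_p} Sel_{p^∞}(E/K)
= corank_{ℤ_p} Sel_{p^∞}(E/ℚ) + corank_{ℤ_p} Sel_{p^∞}(E^{d_K}/ℚ). Verbatim the body of the tree
fact Literature.NumberTheory.EllipticCurves.selmerCorank_baseChange_quadratic, which is PROVED
(theorem selmerCorank_baseChange_quadratic_holds in
Literature.NumberTheory.EllipticCurves.BSDSelmerParityDokchitserBaseChangeProofs): a prover closes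
this item in one line in a Theorems file importing that module; it is stated by name here so the
route file itself stays off that 168-module import stack (cone repair, rev 1). [difficulty:
provable-now] -/
@[route_item "route-BirchSwinnertonDyer-MockTateDerivative", crux]
def QuadraticSelmerCorank : Prop :=
  ∀ (W : WeierstrassCurve ℚ) [W.IsElliptic] (K : Type) [Field K] [NumberField K], Module.finrank ℚ K = 2 → ∀ (p : ℕ) [Fact p.Prime], (W.baseChange K).selmerCorank p = W.selmerCorank p + (W.quadraticTwist (NumberField.discr K : ℚ)).selmerCorank p

-- earlier Assembly (stmt-BirchSwinnertonDyer-18496, replaced 2026-08-17T16:47:13Z -> stmt-BirchSwinnertonDyer-18597): retired by None — MockNonVanishing → VerticalKolyvagin → FieldSupply → SelmerRankShaPFinite → RankLeOne → BSDOffTateSector → _root_.BirchSwinnertonDyer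
/-- item stmt-BirchSwinnertonDyer-18597 · assembly · rank 1 · open · by planner
sources: arXiv:2311.03100, GreenbergLNM1716
[assembly] MockNonVanishing → VerticalKolyvagin → FieldSupply → QuadraticSelmerCorank →
SelmerRankShaPFinite → RankLeOne → BSDOffTateSector → BSD-rank for every E/ℚ (rev 1: the quadratic
corank decomposition is the support item QuadraticSelmerCorank; the deciding theorem `closes` has
exactly these seven binders, all consumed). -/
@[route_item "route-BirchSwinnertonDyer-MockTateDerivative"]
def Assembly : Prop :=
  MockNonVanishing → VerticalKolyvagin → FieldSupply → QuadraticSelmerCorank → SelmerRankShaPFinite → RankLeOne → BSDOffTateSector → _root_.BirchSwinnertonDyer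

/-! D-0027 §2.1 — DECIDING THEOREM (planner-authored via `route open/edit --closes-file`; by planner-rrepair-BirchSwinnertonDyer-MockTateDe-a33365ac-0 2026-08-17T16:46:22Z):
its hypotheses are this route's items and its conclusion the sub-problem Statement (glue_lint), and it elaborates with this file. -/

/-- DECIDING THEOREM (D-0027 §2.1). On a global minimal model `V` of the given curve: analytic rank `≤ 1` is
`RankLeOne` (Gross–Zagier–Kolyvagin); analytic rank `≥ 2` off the non-split Tate sector is the declared residual
`BSDOffTateSector`; ON the sector, `FieldSupply` gives an admissible `K` (`[K:ℚ] = 2`, totally complex, p inert,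
`M ∣ c` with `β² − d_K = 4c`, `d_K < -4`, `r_an(E^{d_K}) = 0`), `MockNonVanishing` gives a parametrisation `Dt`, a
level `p^n`, the CM points `τ = x(p^n)`, `τ₁ = x(1)` (explicit points of `ℍ`), the fields `K[p^n] = K(j(τ))`,
`K[1] = K(j(τ₁))` inside `ℂ` and the finite-level mock-plectic certificate, `VerticalKolyvagin` (Fornea–Gehrmann
2023, Thm. 1.1) turns it into `corank Sel_{p^∞}(E/K) = 2`, the corank decomposition over a quadratic field
`QuadraticSelmerCorank` (a support item; in the tree it is the proved fact `selmerCorank_baseChange_quadratic`) and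
`RankLeOne` on the rank-0 twist give `corank Sel_{p^∞}(E/ℚ) = 2`, and `SelmerRankShaPFinite` with Greenberg's
identity (`selmerCorank_eq_mordellWeilRank_add_holds`) gives `rank E(ℚ) = 2 = r_an`. Transport back to the given
model by isomorphism invariance of the rank and of the analytic rank. -/
@[closes "route-BirchSwinnertonDyer-MockTateDerivative"] theorem closes (hNV : MockNonVanishing) (hVK : VerticalKolyvagin) (hFS : FieldSupply)
    (hQuad : QuadraticSelmerCorank) (hSha : SelmerRankShaPFinite) (hR1 : RankLeOne) (hRes : BSDOffTateSector) :
    _root_.BirchSwinnertonDyer := by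
  have hId : ∀ (W : WeierstrassCurve ℚ), W.selmerCorank_eq_mordellWeilRank_add :=
    fun W => W.selmerCorank_eq_mordellWeilRank_add_holds
  have hZ : ∀ (W : WeierstrassCurve ℚ) [W.IsElliptic] (p : ℕ) [Fact p.Prime],
      Finite ↥(AddCommGroup.primaryComponent W.sha p) → W.shaCorank p = 0 :=
    Literature.BSD.shaCorank_eq_zero_of_finite
  -- (T1) the Mordell–Weil rank is an isomorphism invariant (AEC III.3.1(b); `VariableChangePoints`)
  have hMW : ∀ (W : WeierstrassCurve ℚ) (C : WeierstrassCurve.VariableChange ℚ),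
      (C • W).mordellWeilRank = W.mordellWeilRank := fun W C =>
    @WeierstrassCurve.VariableChange.finrank_point_variableChange ℚ _ W C (Classical.decEq ℚ)
  -- (T2) the local Euler factor is an isomorphism invariant (AEC VII.1.3(b), VII.2, VII.5.1, C §16)
  have hloc : ∀ (R : Type) [CommRing R] [IsDomain R] [IsDiscreteValuationRing R]
      (K : Type) [Field K] [Algebra R K] [IsFractionRing R K]
      (W : WeierstrassCurve K) [W.IsElliptic] (C : WeierstrassCurve.VariableChange K),
      (C • W).localEulerFactor R = W.localEulerFactor R := by
    intro R _ _ _ K _ _ _ W _ C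
    obtain ⟨D, hD⟩ : ∃ D : WeierstrassCurve.VariableChange K,
        (C • W).minimal R = D • W.minimal R :=
      ⟨((C • W).exists_isMinimal R).choose * C * ((W.exists_isMinimal R).choose)⁻¹, by
        rw [WeierstrassCurve.minimal, WeierstrassCurve.minimal, mul_smul, mul_smul, inv_smul_smul]⟩
    haveI hE : (W.minimal R).IsElliptic := by rw [WeierstrassCurve.minimal]; infer_instance
    have hΔ : (W.minimal R).Δ ≠ 0 := (W.minimal R).isUnit_Δ.ne_zero
    have hgood : ((C • W).minimal R).HasGoodReduction R ↔ (W.minimal R).HasGoodReduction R := by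
      rw [WeierstrassCurve.hasGoodReduction_iff, WeierstrassCurve.hasGoodReduction_iff,
        WeierstrassCurve.valuation_Δ_eq_of_isMinimal_of_eq_smul R hD]
      exact and_congr_left' ⟨fun _ => inferInstance, fun _ => inferInstance⟩
    have hcard : Nat.card (((C • W).minimal R).reduction R).toAffine.Point =
        Nat.card ((W.minimal R).reduction R).toAffine.Point := by
      obtain ⟨E, hE⟩ := WeierstrassCurve.exists_reduction_eq_smul R hD hΔ
      rw [hE]
      exact WeierstrassCurve.natCard_point_smul _ _
    have hpoly : (C • W).localPolynomial R = W.localPolynomial R := by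
      classical
      unfold WeierstrassCurve.localPolynomial
      simp only [hgood, hcard,
        WeierstrassCurve.hasSplitMultiplicativeReduction_iff_of_isMinimal_of_eq_smul R hD hΔ,
        WeierstrassCurve.hasMultiplicativeReduction_iff_of_isMinimal_of_eq_smul R hD hΔ]
    simp only [WeierstrassCurve.localEulerFactor, WeierstrassCurve.localPowerSeries, hpoly]
  -- (T3) hence the analytic rank is an isomorphism invariant (AEC App. C §16)
  have hAn : ∀ (W : WeierstrassCurve ℚ) [W.IsElliptic] (C : WeierstrassCurve.VariableChange ℚ),
      (C • W).analyticRank = W.analyticRank := by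
    intro W _ C
    have hL : (C • W).LFunction = W.LFunction := by
      unfold WeierstrassCurve.LFunction
      congr 1
      funext v
      simp only [WeierstrassCurve.baseChange, ← WeierstrassCurve.map_variableChange]
      exact hloc _ _ _ _
    have hLS : (C • W).LSeries = W.LSeries := by
      funext s
      simp only [WeierstrassCurve.LSeries, hL]
    have hEC : (C • W).entireContinuations = W.entireContinuations := by
      simp only [WeierstrassCurve.entireContinuations, hLS]
    have hEL : (C • W).entireLFunction = W.entireLFunction := by
      unfold WeierstrassCurve.entireLFunction
      rw [hEC, hLS]
    simp only [WeierstrassCurve.analyticRank, hEL]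
  -- BSD-rank on a global minimal model, in three regimes
  have key : ∀ (V : WeierstrassCurve ℚ) [V.IsElliptic] [V.IsGloballyMinimal],
      V.analyticRank = V.mordellWeilRank := by
    intro V _ _
    by_cases h1 : V.analyticRank ≤ 1
    · exact ((hR1 V h1).1).symm
    by_cases hsec : ∃ (p M : ℕ) (_ : Fact p.Prime), 5 ≤ p ∧ V.conductorNorm ℤ = p * M ∧ ¬ p ∣ M ∧
        V.HasMultiplicativeReductionAtPrime p ∧
        ¬ ((V.baseChange ℚ_[p]).minimal ℤ_[p]).HasSplitMultiplicativeReduction ℤ_[p] ∧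
        V.HasSurjectiveModNGaloisRep p ∧ V.analyticRank = 2
    · -- the non-split Tate sector: mock plectic certificate ⇒ corank 2 over K ⇒ rank 2 over ℚ
      obtain ⟨p, M, hp, h5, hN, hpM, hm, hns, hsurj, hr2⟩ := hsec
      haveI := hp
      have hM0 : M ≠ 0 := by rintro rfl; exact hpM (dvd_zero p)
      haveI : NeZero (V.conductorNorm ℤ) := ⟨by rw [hN]; exact mul_ne_zero hp.out.ne_zero hM0⟩
      obtain ⟨K, _, _, β, c, hK2, hKc, hd4, hgcd, hinert, hβ, hMc, htw⟩ := hFS V p M hN hpM hr2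
      obtain ⟨ι⟩ : Nonempty (K →+* ℂ) := inferInstance
      obtain ⟨Dt, n, τ, τ₁, L, L₁, y, σ, S, hn, hτ, hτ₁, hL, hL₁, hy, hσ, hS1, hS2, hcert⟩ :=
        hNV V p M h5 hN hpM hm hns hsurj hr2 K ι β c hK2 hKc hd4 hgcd hinert hβ hMc htw
      have hK : (V.baseChange K).selmerCorank p = 2 :=
        hVK V p M h5 hN hpM hm hns hsurj (by omega) K ι β c hK2 hKc hd4 hgcd hinert hβ hMc Dt n τ τ₁ L L₁
          y σ S hn hτ hτ₁ hL hL₁ hy hσ hS1 hS2 hcert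
      have hdec : (V.baseChange K).selmerCorank p =
          V.selmerCorank p + (V.quadraticTwist (NumberField.discr K : ℚ)).selmerCorank p :=
        hQuad V K hK2 p
      have hd : (NumberField.discr K : ℚ) ≠ 0 := by exact_mod_cast NumberField.discr_ne_zero K
      haveI := V.isElliptic_quadraticTwist hd
      obtain ⟨hTrk, -⟩ := hR1 (V.quadraticTwist (NumberField.discr K : ℚ)) (by omega)
      have hT1 := hId (V.quadraticTwist (NumberField.discr K : ℚ)) p
      have hT2 := hZ (V.quadraticTwist (NumberField.discr K : ℚ)) p (hSha _ p)
      have hV1 := hId V p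
      have hV3 := hZ V p (hSha V p)
      omega
    · exact hRes V (by omega) hsec
  -- transport to an arbitrary model
  intro W hE
  haveI := hE
  obtain ⟨C, hC⟩ := WeierstrassCurve.hasGlobalMinimalModel_rat_holds W
  haveI := hC
  have h := key (C • W)
  rw [hAn W C, hMW W C] at h
  exact h

end Summit.BirchSwinnertonDyer.BirchSwinnertonDyer.Theses.MockTateDerivative
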